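import Literature.Computability.Cryptography.WordRAMAchieves
import HarnessLib

/-!
# OV → LCS on the word RAM, I: range-dispatch combinators for writing gadget strings bit by bit

Generic structured word-RAM code (`SProg`, logic `SProg.Achieves` of
`…Cryptography.WordRAMAchieves`) used by the reduction program of
`Literature.Computability.FineGrained.LCSFromOVProgram`, which writes the strings of
Bringmann–Künnemann's OV → LCS reduction (FOCS 2015, §3.1/§4) one bit per loop iteration:

* `LCSRed.Kept S R R'`: the register files agree outside the list `S` of written registers, and
  the standard shape `LCSRed.Post S R H'` of the certificates below (data `= H'`, registers kept
  outside `S`);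
* `LCSRed.sixWay rr tgt b₁ b₂ b₃ b₄ b₅ inner`: dispatch on the offset `r` (register `rr`) inside a
  period `1^{γ₂} 0^{γ₁} z 0^{γ₁} 1^{γ₂} 0^{γ₃}` with boundaries `b₁ = γ₂ ≤ b₂ ≤ b₃ ≤ b₄ ≤ b₅` held in
  registers: write the constant bit of the five constant ranges to the data cell addressed by
  register `tgt`, or set `rr := r - b₂` and run `inner` (the range of `z`); certificate
  `LCSRed.sixWay_spec` (`inner`'s certificate in, `12` extra steps);
* `LCSRed.threeWay rp tgt c₁ c₂ inner`: dispatch on `p` (register `rp`) inside `0^{c₁} core 0^{⋯}`: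
  write `0`, or set register `6 := p - c₁` and run `inner`; certificate `LCSRed.threeWay_spec`
  (`7` extra steps).

[folklore] engineering (Nipkow–Klein, *Concrete Semantics*, §12: structured programs by rules).
-/

namespace Literature.Computability.FineGrained.LCSRed

open Cryptography Cryptography.WordRAM Cryptography.WordRAM.SProg

/-! ### Operand shorthands -/

/-- Direct operand: register / cell `i`. [folklore] -/
abbrev r (i : ℕ) : Operand := .dir i
/-- Indirect operand through cell `i`. [folklore] -/
abbrev pt (i : ℕ) : Operand := .ind i
/-- Immediate operand. [folklore] -/
abbrev im (c : ℕ) : Operand := .imm c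

/-! ### Registers kept, and the standard shape of certificates -/

/-- `Kept S R R'`: the register files agree outside the written registers `S`. [folklore] -/
def Kept (S : List ℕ) (R R' : ℕ → ℕ) : Prop := ∀ a, a ∉ S → R' a = R a

/-- `Kept` is reflexive. [folklore] -/
theorem Kept.rfl {S : List ℕ} {R : ℕ → ℕ} : Kept S R R := fun _ _ => _root_.rfl

/-- `Kept` is transitive, accumulating the written registers. [folklore] -/
theorem Kept.trans {S S' : List ℕ} {R R' R'' : ℕ → ℕ} (h₁ : Kept S R R') (h₂ : Kept S' R' R'') :
    Kept (S ++ S') R R'' := fun a ha => by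
  rw [List.mem_append, not_or] at ha
  exact (h₂ a ha.2).trans (h₁ a ha.1)

/-- Enlarging the list of written registers. [folklore] -/
theorem Kept.mono {S S' : List ℕ} {R R' : ℕ → ℕ} (h : Kept S R R') (hS : ∀ a ∈ S, a ∈ S') :
    Kept S' R R' := fun a ha => h a fun h' => ha (hS a h')

/-- Updating a listed register keeps the rest. [folklore] -/
theorem Kept.update {S : List ℕ} {R R' : ℕ → ℕ} (h : Kept S R R') {a : ℕ} (ha : a ∈ S) (v : ℕ) :
    Kept S R (Function.update R' a v) := fun b hb => by
  have hba : b ≠ a := fun e => hb (by rw [e]; exact ha)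
  rw [Function.update_of_ne hba]; exact h b hb

/-- The standard shape of a certificate: the data become `H'`, the registers are kept outside `S`.
[folklore] -/
def Post (S : List ℕ) (R H' : ℕ → ℕ) (m : ℕ → ℕ) : Prop := ∃ R', m = merge R' H' ∧ Kept S R R'

/-- Weakening the standard shape. [folklore] -/
theorem Post.mono {S S' : List ℕ} {R H' : ℕ → ℕ} {m : ℕ → ℕ} (h : Post S R H' m)
    (hS : ∀ a ∈ S, a ∈ S') : Post S' R H' m := by
  obtain ⟨R', hm, hK⟩ := h; exact ⟨R', hm, hK.mono hS⟩

/-- Writing the word `v` into the data cell addressed by register `tgt` (one instruction) meets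
the standard shape with no register written. [folklore] -/
theorem achieves_write {W : ℕ} {O : List ℕ → List ℕ} {R H : ℕ → ℕ} {tgt v T : ℕ} (S : List ℕ)
    (htgt : tgt < 100) (hT : 100 ≤ R tgt) (hv : v < 2 ^ W) (h1 : 1 ≤ T) :
    Achieves W O (op .add (pt tgt) (im v) (im 0)) (merge R H)
      (Post S R (Function.update H (R tgt) v)) T := by
  refine Achieves.op ?_ h1
  refine ⟨R, ?_, Kept.rfl⟩
  simp only [Operand.write, Operand.read, merge_apply_of_lt htgt, update_merge_of_le _ _ hT,
    BinOp.eval_add_of_lt (show v + 0 < 2 ^ W by omega), Nat.add_zero]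

/-- The test `2 := [rr < b]`. [folklore] -/
theorem achieves_test {W : ℕ} {O : List ℕ → List ℕ} {R H : ℕ → ℕ} {rr b rv vb : ℕ} (hrr : rr < 100)
    (hb : b < 100) (hRr : R rr = rv) (hRb : R b = vb) :
    Achieves W O (op .lt (r 2) (r rr) (r b)) (merge R H)
      (fun m => m = merge (Function.update R 2 (if rv < vb then 1 else 0)) H) 1 := by
  refine Achieves.op ?_ le_rfl
  simp only [Operand.write, Operand.read, merge_apply_of_lt hrr, merge_apply_of_lt hb,
    update_merge_of_lt _ _ (show (2 : ℕ) < 100 by omega), hRr, hRb, BinOp.eval_lt]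

/-- Reading back the test register: nonzero iff the comparison held. [folklore] -/
theorem test_read {R H : ℕ → ℕ} {c : Prop} [Decidable c] :
    ((r 2).read (merge (Function.update R 2 (if c then 1 else 0)) H) ≠ 0) ↔ c := by
  simp only [Operand.read, merge_apply_of_lt (show (2 : ℕ) < 100 by omega), Function.update_self]
  by_cases hc : c <;> simp [hc]

/-! ### The six-way range dispatch of a period -/

/-- **Six-way dispatch** on the offset `r` (register `rr`) inside a period
`1^{γ₂} 0^{γ₁} z 0^{γ₁} 1^{γ₂} 0^{γ₃}` whose boundaries `b₁ = γ₂`, `b₂ = γ₂ + γ₁`, `b₃ = b₂ + |z|`,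
`b₄ = b₃ + γ₁`, `b₅ = b₄ + γ₂` sit in the registers `b₁ … b₅`: write `1, 0, 0, 1, 0` in the five
constant ranges to the cell addressed by `tgt`, and in the range of `z` set `rr := r - b₂` and run
`inner`. Register `2` holds the tests. [folklore] -/
def sixWay (rr tgt b₁ b₂ b₃ b₄ b₅ : ℕ) (inner : SProg) : SProg :=
  seq (op .lt (r 2) (r rr) (r b₁)) <|
  ifz (r 2)
    (seq (op .lt (r 2) (r rr) (r b₂)) <|
     ifz (r 2)
       (seq (op .lt (r 2) (r rr) (r b₃)) <|
        ifz (r 2)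
          (seq (op .lt (r 2) (r rr) (r b₄)) <|
           ifz (r 2)
             (seq (op .lt (r 2) (r rr) (r b₅)) <|
              ifz (r 2) (op .add (pt tgt) (im 0) (im 0)) (op .add (pt tgt) (im 1) (im 0)))
             (op .add (pt tgt) (im 0) (im 0)))
          (seq (op .sub (r rr) (r rr) (r b₂)) inner))
       (op .add (pt tgt) (im 0) (im 0)))
    (op .add (pt tgt) (im 1) (im 0))

/-- `sixWay` is query-free if `inner` is. [folklore] -/
theorem sixWay_queryFree {rr tgt b₁ b₂ b₃ b₄ b₅ : ℕ} {inner : SProg} (h : inner.QueryFree) :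
    (sixWay rr tgt b₁ b₂ b₃ b₄ b₅ inner).QueryFree := by
  simp only [sixWay, QueryFree]; tauto

/-- The bit selected by the six-way dispatch: the constant of the range of `r`, or bit `r - b₂`
of `z` (given by `zb`). [folklore] -/
def sixBit (b₁ b₂ b₃ b₄ b₅ : ℕ) (zb : ℕ → Bool) (r : ℕ) : Bool :=
  if r < b₁ then true
  else if r < b₂ then false
  else if r < b₃ then zb (r - b₂)
  else if r < b₄ then false
  else if r < b₅ then true
  else false

/-- **Certificate of the six-way dispatch.** Registers: `rr` holds `rv`, `tgt` a data address,
`b₁ … b₅` the boundary values `v₁ … v₅`, all registers below `100`, the test register `2` distinct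
from all of them and `rr ≠ tgt`, `rr ≠ b₂`. If, whenever `v₂ ≤ rv < v₃`, `inner` — started on any
register file agreeing with `R` outside `2, rr`, with `rr = rv - v₂` — writes the word of
`zb (rv - v₂)` into the target cell within `Tin ≥ 4` steps keeping the registers outside `Sin`,
then `sixWay` writes the word of `sixBit v₁ … v₅ zb rv` within `Tin + 12` steps keeping the
registers outside `2 :: rr :: Sin`. [folklore] -/
theorem sixWay_spec {W : ℕ} {O : List ℕ → List ℕ} {rr tgt b₁ b₂ b₃ b₄ b₅ : ℕ} {inner : SProg}
    {R H : ℕ → ℕ} {rv v₁ v₂ v₃ v₄ v₅ Tin : ℕ} {zb : ℕ → Bool} {Sin : List ℕ}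
    (hrr : rr < 100) (htgt : tgt < 100) (hb₁ : b₁ < 100) (hb₂ : b₂ < 100) (hb₃ : b₃ < 100)
    (hb₄ : b₄ < 100) (hb₅ : b₅ < 100)
    (hrr2 : rr ≠ 2) (htgt2 : tgt ≠ 2) (hrrt : rr ≠ tgt) (hb₁2 : b₁ ≠ 2) (hb₂2 : b₂ ≠ 2)
    (hb₃2 : b₃ ≠ 2) (hb₄2 : b₄ ≠ 2) (hb₅2 : b₅ ≠ 2) (hb₁r : b₁ ≠ rr) (hb₂r : b₂ ≠ rr)
    (hb₃r : b₃ ≠ rr) (hb₄r : b₄ ≠ rr) (hb₅r : b₅ ≠ rr)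
    (hRr : R rr = rv) (hR₁ : R b₁ = v₁) (hR₂ : R b₂ = v₂) (hR₃ : R b₃ = v₃) (hR₄ : R b₄ = v₄)
    (hR₅ : R b₅ = v₅) (hT : 100 ≤ R tgt) (hW : 2 ≤ 2 ^ W) (hrv : rv < 2 ^ W) (hTin : 4 ≤ Tin)
    (hinner : v₂ ≤ rv → rv < v₃ → ∀ R', Kept [2, rr] R R' → R' rr = rv - v₂ →
      Achieves W O inner (merge R' H)
        (Post Sin R' (Function.update H (R tgt) (zb (rv - v₂)).toNat)) Tin) :
    Achieves W O (sixWay rr tgt b₁ b₂ b₃ b₄ b₅ inner) (merge R H)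
      (Post (2 :: rr :: Sin) R (Function.update H (R tgt) (sixBit v₁ v₂ v₃ v₄ v₅ zb rv).toNat))
      (Tin + 12) := by
  have h22 : (2 : ℕ) ∈ [2, rr] := by simp
  -- writing a constant from a register file agreeing with `R` outside `2, rr`
  have write : ∀ {R' : ℕ → ℕ} (c : ℕ), c ≤ 1 → Kept [2, rr] R R' → ∀ {T : ℕ}, 1 ≤ T →
      Achieves W O (op .add (pt tgt) (im c) (im 0)) (merge R' H)
        (Post (2 :: rr :: Sin) R (Function.update H (R tgt) c)) T := by
    intro R' c hc hK T h1
    have hR't : R' tgt = R tgt := hK tgt (by simp [Ne.symm hrrt, htgt2])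
    have := achieves_write (W := W) (O := O) (R := R') (H := H) (v := c) ([] : List ℕ) htgt
      (hR't ▸ hT) (by omega) h1
    rw [hR't] at this
    refine this.mono (Q' := Post (2 :: rr :: Sin) R _) (fun m hm => ?_) le_rfl
    obtain ⟨R'', hm, hK'⟩ := hm
    exact ⟨R'', hm, (hK.trans hK').mono (by simp)⟩
  -- one dispatch level: test, then branch
  have level : ∀ {R' : ℕ → ℕ} {b vb : ℕ} {s u : SProg} {Q : (ℕ → ℕ) → Prop} {T : ℕ},
      b < 100 → b ≠ 2 → b ≠ rr → Kept [2, rr] R R' → R' rr = rv → R b = vb →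
      (¬ rv < vb → Achieves W O s (merge (Function.update R' 2 (if rv < vb then 1 else 0)) H) Q T) →
      (rv < vb → Achieves W O u (merge (Function.update R' 2 (if rv < vb then 1 else 0)) H) Q T) →
      Achieves W O (seq (op .lt (r 2) (r rr) (r b)) (ifz (r 2) s u)) (merge R' H) Q (1 + (T + 2)) := by
    intro R' b vb s u Q T hb hb2 hbr hK hR'r hRb h0 h1
    have hR'b : R' b = vb := (hK b (by simp [hb2, hbr])).trans hRb
    refine Achieves.seq (achieves_test hrr hb hR'r hR'b) fun m hm => ?_
    subst hm
    exact Achieves.ifz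
      (fun hz => h0 fun hlt => absurd hz ((test_read (R := R') (H := H) (c := rv < vb)).2 hlt))
      (fun hnz => h1 ((test_read (R := R') (H := H) (c := rv < vb)).1 hnz))
  -- reading `rr` through updates of register `2`
  have rd : ∀ {R' : ℕ → ℕ} (t : ℕ), R' rr = rv → Function.update R' 2 t rr = rv := fun t h => by
    rw [Function.update_of_ne hrr2, h]
  refine (level (T := Tin + 9) hb₁ hb₁2 hb₁r Kept.rfl hRr hR₁ (fun hge₁ => ?_) (fun hlt₁ => ?_)).mono
    (T' := Tin + 12) (fun _ h => h) (by omega)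
  swap
  · exact (write 1 le_rfl (Kept.rfl.update h22 _) (T := Tin + 9) (by omega)).mono
      (fun m hm => by simpa [sixBit, hlt₁] using hm) le_rfl
  have K1 : Kept [2, rr] R (Function.update R 2 (if rv < v₁ then 1 else 0)) := Kept.rfl.update h22 _
  refine (level (T := Tin + 6) hb₂ hb₂2 hb₂r K1 (rd _ hRr) hR₂ (fun hge₂ => ?_) (fun hlt₂ => ?_)).mono
    (T' := Tin + 9) (fun _ h => h) (by omega)
  swap
  · exact (write 0 (by omega) (K1.update h22 _) (T := Tin + 6) (by omega)).mono
      (fun m hm => by simpa [sixBit, hge₁, hlt₂] using hm) le_rfl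
  have K2 := K1.update h22 (if rv < v₂ then 1 else 0)
  refine (level (T := Tin + 3) hb₃ hb₃2 hb₃r K2 (rd _ (rd _ hRr)) hR₃ (fun hge₃ => ?_)
    (fun hlt₃ => ?_)).mono (T' := Tin + 6) (fun _ h => h) (by omega)
  swap
  · -- the range of `z`: `rr := rv - v₂`, then `inner`
    have K3 := K2.update h22 (if rv < v₃ then 1 else 0)
    have hsub : Achieves W O (op .sub (r rr) (r rr) (r b₂))
        (merge (Function.update (Function.update (Function.update R 2 (if rv < v₁ then 1 else 0)) 2
          (if rv < v₂ then 1 else 0)) 2 (if rv < v₃ then 1 else 0)) H)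
        (fun m => m = merge (Function.update (Function.update (Function.update (Function.update R 2
          (if rv < v₁ then 1 else 0)) 2 (if rv < v₂ then 1 else 0)) 2 (if rv < v₃ then 1 else 0)) rr
          (rv - v₂)) H) 1 := by
      refine Achieves.op ?_ le_rfl
      simp only [Operand.write, Operand.read, merge_apply_of_lt hrr, merge_apply_of_lt hb₂,
        update_merge_of_lt _ _ hrr, Function.update_of_ne hrr2, Function.update_of_ne hb₂2, hRr, hR₂,
        BinOp.eval_sub_of_le (not_lt.1 hge₂) hrv]
    refine (Achieves.seq (T₁ := 1) (T₂ := Tin) hsub fun m hm => ?_).mono (T' := Tin + 3)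
      (fun _ h => h) (by omega)
    subst hm
    have K3' := K3.update (show rr ∈ [2, rr] by simp) (rv - v₂)
    have := hinner (not_lt.1 hge₂) hlt₃ _ K3' (by rw [Function.update_self])
    refine this.mono (Q' := Post (2 :: rr :: Sin) R _) (fun m hm => ?_) le_rfl
    obtain ⟨R'', hm, hK''⟩ := hm
    refine ⟨R'', ?_, K3'.trans hK''⟩
    rw [hm]; simp [sixBit, hge₁, hge₂, hlt₃]
  have K3 := K2.update h22 (if rv < v₃ then 1 else 0)
  refine (level (T := Tin) hb₄ hb₄2 hb₄r K3 (rd _ (rd _ (rd _ hRr))) hR₄ (fun hge₄ => ?_)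
    (fun hlt₄ => ?_)).mono (T' := Tin + 3) (fun _ h => h) (by omega)
  swap
  · exact (write 0 (by omega) (K3.update h22 _) (T := Tin) (by omega)).mono
      (fun m hm => by simpa [sixBit, hge₁, hge₂, hge₃, hlt₄] using hm) le_rfl
  have K4 := K3.update h22 (if rv < v₄ then 1 else 0)
  refine (level (T := Tin - 3) hb₅ hb₅2 hb₅r K4 (rd _ (rd _ (rd _ (rd _ hRr)))) hR₅ (fun hge₅ => ?_)
    (fun hlt₅ => ?_)).mono (T' := Tin) (fun _ h => h) (by omega)
  · exact (write 0 (by omega) (K4.update h22 _) (T := Tin - 3) (by omega)).mono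
      (fun m hm => by simpa [sixBit, hge₁, hge₂, hge₃, hge₄, hge₅] using hm) le_rfl
  · exact (write 1 le_rfl (K4.update h22 _) (T := Tin - 3) (by omega)).mono
      (fun m hm => by simpa [sixBit, hge₁, hge₂, hge₃, hge₄, hlt₅] using hm) le_rfl

/-! ### The three-way range dispatch of a padded string -/

/-- **Three-way dispatch** on `p` (register `rp`) inside `0^{c₁} core 0^{⋯}` with the boundaries
`c₁`, `c₂ = c₁ + |core|` in registers: write `0` outside the core, and inside it set register
`6 := p - c₁` and run `inner`. Register `2` holds the tests. [folklore] -/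
def threeWay (rp tgt c₁ c₂ : ℕ) (inner : SProg) : SProg :=
  seq (op .lt (r 2) (r rp) (r c₁)) <|
  ifz (r 2)
    (seq (op .lt (r 2) (r rp) (r c₂)) <|
     ifz (r 2) (op .add (pt tgt) (im 0) (im 0)) (seq (op .sub (r 6) (r rp) (r c₁)) inner))
    (op .add (pt tgt) (im 0) (im 0))

/-- `threeWay` is query-free if `inner` is. [folklore] -/
theorem threeWay_queryFree {rp tgt c₁ c₂ : ℕ} {inner : SProg} (h : inner.QueryFree) :
    (threeWay rp tgt c₁ c₂ inner).QueryFree := by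
  simp only [threeWay, QueryFree]; tauto

/-- The bit selected by the three-way dispatch. [folklore] -/
def threeBit (c₁ c₂ : ℕ) (cb : ℕ → Bool) (p : ℕ) : Bool :=
  if p < c₁ then false else if p < c₂ then cb (p - c₁) else false

/-- **Certificate of the three-way dispatch.** Registers: `rp` holds `pv` (`rp` may be `6`),
`tgt` a data address, `c₁, c₂` the boundary values; the written registers are `2` and `6`. If,
whenever `v₁ ≤ pv < v₂`, `inner` — started on any register file agreeing with `R` outside `2, 6`,
with register `6 = pv - v₁` — writes the word of `cb (pv - v₁)` within `Tin ≥ 1` steps keeping the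
registers outside `Sin`, then `threeWay` writes the word of `threeBit v₁ v₂ cb pv` within `Tin + 7`
steps keeping the registers outside `2 :: 6 :: Sin`. [folklore] -/
theorem threeWay_spec {W : ℕ} {O : List ℕ → List ℕ} {rp tgt c₁ c₂ : ℕ} {inner : SProg}
    {R H : ℕ → ℕ} {pv v₁ v₂ Tin : ℕ} {cb : ℕ → Bool} {Sin : List ℕ}
    (hrp : rp < 100) (htgt : tgt < 100) (hc₁ : c₁ < 100) (hc₂ : c₂ < 100)
    (hrp2 : rp ≠ 2) (htgt2 : tgt ≠ 2) (htgt6 : tgt ≠ 6) (hc₁2 : c₁ ≠ 2) (hc₂2 : c₂ ≠ 2)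
        (hRp : R rp = pv) (hR₁ : R c₁ = v₁) (hR₂ : R c₂ = v₂) (hT : 100 ≤ R tgt) (hW : 2 ≤ 2 ^ W)
    (hpv : pv < 2 ^ W) (hTin : 1 ≤ Tin)
    (hinner : v₁ ≤ pv → pv < v₂ → ∀ R', Kept [2, 6] R R' → R' 6 = pv - v₁ →
      Achieves W O inner (merge R' H)
        (Post Sin R' (Function.update H (R tgt) (cb (pv - v₁)).toNat)) Tin) :
    Achieves W O (threeWay rp tgt c₁ c₂ inner) (merge R H)
      (Post (2 :: 6 :: Sin) R (Function.update H (R tgt) (threeBit v₁ v₂ cb pv).toNat)) (Tin + 7) := by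
  have h22 : (2 : ℕ) ∈ [2, 6] := by simp
  have write : ∀ {R' : ℕ → ℕ}, Kept [2, 6] R R' → ∀ {T : ℕ}, 1 ≤ T →
      Achieves W O (op .add (pt tgt) (im 0) (im 0)) (merge R' H)
        (Post (2 :: 6 :: Sin) R (Function.update H (R tgt) 0)) T := by
    intro R' hK T h1
    have hR't : R' tgt = R tgt := hK tgt (by simp [htgt2, htgt6])
    have := achieves_write (W := W) (O := O) (R := R') (H := H) (v := 0) ([] : List ℕ) htgt
      (hR't ▸ hT) (by omega) h1
    rw [hR't] at this
    refine this.mono (Q' := Post (2 :: 6 :: Sin) R _) (fun m hm => ?_) le_rfl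
    obtain ⟨R'', hm, hK'⟩ := hm
    exact ⟨R'', hm, (hK.trans hK').mono (by simp)⟩
  unfold threeWay
  -- first test
  refine (Achieves.seq (T₁ := 1) (T₂ := Tin + 6) (achieves_test hrp hc₁ hRp hR₁) fun m hm => ?_).mono
    (T' := Tin + 7) (fun _ h => h) (by omega)
  subst hm
  have K1 : Kept [2, 6] R (Function.update R 2 (if pv < v₁ then 1 else 0)) := Kept.rfl.update h22 _
  refine (Achieves.ifz (T := Tin + 4) (fun hz => ?_) (fun hnz => ?_)).mono (T' := Tin + 6)
    (fun _ h => h) (by omega)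
  swap
  · have hlt₁ := (test_read (R := R) (H := H) (c := pv < v₁)).1 hnz
    exact (write K1 (T := Tin + 4) (by omega)).mono
      (fun m hm => by simpa [threeBit, hlt₁] using hm) le_rfl
  have hge₁ : ¬ pv < v₁ := fun h => (test_read (R := R) (H := H) (c := pv < v₁)).2 h hz
  -- second test
  have hRp' : Function.update R 2 (if pv < v₁ then 1 else 0) rp = pv := by
    rw [Function.update_of_ne hrp2, hRp]
  have hR₂' : Function.update R 2 (if pv < v₁ then 1 else 0) c₂ = v₂ := by
    rw [Function.update_of_ne hc₂2, hR₂]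
  refine (Achieves.seq (T₁ := 1) (T₂ := Tin + 3) (achieves_test hrp hc₂ hRp' hR₂') fun m hm => ?_).mono
    (T' := Tin + 4) (fun _ h => h) (by omega)
  subst hm
  rw [Function.update_idem]
  have K2 : Kept [2, 6] R (Function.update R 2 (if pv < v₂ then 1 else 0)) := Kept.rfl.update h22 _
  refine (Achieves.ifz (T := Tin + 1) (fun hz' => ?_) (fun hnz' => ?_)).mono (T' := Tin + 3)
    (fun _ h => h) (by omega)
  · have hge₂ : ¬ pv < v₂ := fun h =>
      hz' |> fun h0 => absurd h0 ((test_read (R := R) (H := H) (c := pv < v₂)).2 h)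
    exact (write K2 (T := Tin + 1) (by omega)).mono
      (fun m hm => by simpa [threeBit, hge₁, hge₂] using hm) le_rfl
  · have hlt₂ := (test_read (R := R) (H := H) (c := pv < v₂)).1 hnz'
    have hsub : Achieves W O (op .sub (r 6) (r rp) (r c₁))
        (merge (Function.update R 2 (if pv < v₂ then 1 else 0)) H)
        (fun m => m = merge (Function.update (Function.update R 2 (if pv < v₂ then 1 else 0)) 6
          (pv - v₁)) H) 1 := by
      refine Achieves.op ?_ le_rfl
      simp only [Operand.write, Operand.read, merge_apply_of_lt hrp, merge_apply_of_lt hc₁,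
        update_merge_of_lt _ _ (show (6 : ℕ) < 100 by omega), Function.update_of_ne hrp2,
        Function.update_of_ne hc₁2, hRp, hR₁, BinOp.eval_sub_of_le (not_lt.1 hge₁) hpv]
    refine (Achieves.seq (T₁ := 1) (T₂ := Tin) hsub fun m hm => ?_).mono (T' := Tin + 1)
      (fun _ h => h) (by omega)
    subst hm
    have K2' := K2.update (show (6 : ℕ) ∈ [2, 6] by simp) (pv - v₁)
    have := hinner (not_lt.1 hge₁) hlt₂ _ K2' (by rw [Function.update_self])
    refine this.mono (Q' := Post (2 :: 6 :: Sin) R _) (fun m hm => ?_) le_rfl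
    obtain ⟨R'', hm, hK''⟩ := hm
    refine ⟨R'', ?_, K2'.trans hK''⟩
    rw [hm]; simp [threeBit, hge₁, hlt₂]

end Literature.Computability.FineGrained.LCSRed
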